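import Literature.AlgebraicGeometry.Motives.GrassmannianSchemeSmooth
import Literature.AlgebraicGeometry.Motives.VarietiesProjectiveSpaceProofs
import HarnessLib

/-!
# The Grassmannian scheme is smooth over `ℤ` of relative dimension `k (n - k)`

Topic `AlgebraicGeometry/Motives`; namespace `Literature.AlgebraicGeometry.Motives.Grassmannian`.  THEOREMS ONLY
(no definition, no instance, no notation, no named fact, no `sorry`).  (h4) brick (A11): the last clause of
[GortzWedhorn2020, Cor. 8.15 (p. 216)] — `Grass_{d,n} → Spec ℤ` is smooth OF RELATIVE DIMENSION `d(n − d)` (the charts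
are affine spaces `𝔸^{d(n−d)}_ℤ`).  Road: Mathlib `SmoothOfRelativeDimension n` is Zariski-local on the source
(`HasRingHomProperty … (Locally (IsStandardSmoothOfRelativeDimension n))`); over the chart cover ★
`exists_openImmersion_chartScheme_cover` ((A7)) each chart is `Spec ℤ[X_{σ_I × Fin k}] → Spec ℤ`, `Spec` of
`ℤ → ℤ[X_σ]`, standard smooth of relative dimension `#σ` (★ `ProjectiveSpace.isStandardSmoothOfRelativeDimension_mvPolynomial_fin`
transported along `MvPolynomial.renameEquiv`), and `#(σ_I × Fin k) = k (n − k)` for `n = finrank_ℤ M`, `I` injective.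

* **`smoothOfRelativeDimension_terminal_from : SmoothOfRelativeDimension (k * (Module.finrank ℤ M - k)) (terminal.from (grassmannianScheme M k))`**
  (`M` finite free; for `k > finrank M` the scheme is empty and the statement holds with `k * 0 = 0`).

References: [GortzWedhorn2020] Cor. 8.15 (p. 216); [Hartshorne1977] III §10 Example 10.0.1 (`𝔸ⁿ_Y → Y` smooth of relative
dimension `n`); [StacksProject, Tag 089T].  Cell `hodgecm-mathlib` (D-0151), count-neutral Mathlib-side capital; nothing here
is about HC — HC_CM is proved only modulo the 7 printed citations until rung 0 closes.
-/

universe u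

open CategoryTheory CategoryTheory.Limits Opposite _root_.AlgebraicGeometry

namespace Literature.AlgebraicGeometry.Motives.Grassmannian

section RelativeDimension

variable (M : Type u) [AddCommGroup M] (k : ℕ) [(grassmannianSheaf M k).obj.IsRepresentable]

/-- `ℤ[X_σ]` is standard smooth over `ℤ` of relative dimension `#σ` (`σ` finite, any universe): the tree's
`Fin n` statement transported along `MvPolynomial.renameEquiv`. [folklore] -/
private theorem isStandardSmoothOfRelativeDimension_mvPolynomial_int (σ : Type u) [Finite σ] :
    Algebra.IsStandardSmoothOfRelativeDimension (Nat.card σ) ℤ (MvPolynomial σ ℤ) := by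
  haveI := ProjectiveSpace.isStandardSmoothOfRelativeDimension_mvPolynomial_fin ℤ (Nat.card σ)
  exact Algebra.IsStandardSmoothOfRelativeDimension.of_algEquiv (n := Nat.card σ) (R := ℤ)
    (S := MvPolynomial (Fin (Nat.card σ)) ℤ) (e := MvPolynomial.renameEquiv ℤ (Finite.equivFin σ).symm)

/-- The structure morphism `Spec ℤ[X_{σ_I × Fin k}] → ⊤` of a chart is smooth of relative dimension `#(σ_I × Fin k)`.
[cite: Hartshorne1977, III §10 Example 10.0.1] -/
private theorem smoothOfRelativeDimension_terminal_from_chartScheme {J : Type u} [Finite J] (k : ℕ) (I : Fin k → J) :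
    SmoothOfRelativeDimension (Nat.card ({j : J // j ∉ Set.range I} × Fin k)) (terminal.from (chartScheme k I)) := by
  have := isIso_of_isTerminal specULiftZIsTerminal.{u} terminalIsTerminal (terminal.from _)
  let φ : ULift.{u} ℤ →+* MvPolynomial ({j : J // j ∉ Set.range I} × Fin k) ℤ :=
    (algebraMap ℤ _).comp ULift.ringEquiv.toRingHom
  change SmoothOfRelativeDimension _ (terminal.from (Spec (CommRingCat.of (MvPolynomial _ ℤ))))
  rw [← terminal.comp_from (Spec.map (CommRingCat.ofHom φ)),
    MorphismProperty.cancel_right_of_respectsIso (P := @SmoothOfRelativeDimension _),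
    HasRingHomProperty.Spec_iff (P := @SmoothOfRelativeDimension _)]
  refine RingHom.locally_of RingHom.isStandardSmoothOfRelativeDimension_respectsIso _ ?_
  change RingHom.IsStandardSmoothOfRelativeDimension _ φ
  haveI := isStandardSmoothOfRelativeDimension_mvPolynomial_int ({j : J // j ∉ Set.range I} × Fin k)
  have h := RingHom.IsStandardSmoothOfRelativeDimension.comp
    ((RingHom.isStandardSmoothOfRelativeDimension_algebraMap (R := ℤ)
      (S := MvPolynomial ({j : J // j ∉ Set.range I} × Fin k) ℤ) (Nat.card ({j : J // j ∉ Set.range I} × Fin k))).mpr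
      inferInstance)
    (RingHom.IsStandardSmoothOfRelativeDimension.equiv (ULift.ringEquiv : ULift.{u} ℤ ≃+* ℤ))
  rw [Nat.add_zero] at h
  exact h

/-- Cardinality of the chart variables: for `J` finite and `I : Fin k → J` injective,
`#({j // j ∉ range I} × Fin k) = k · (#J − k)`. [folklore] -/
private theorem natCard_chartVars {J : Type u} [Finite J] (k : ℕ) (I : Fin k → J) (hI : Function.Injective I) :
    Nat.card ({j : J // j ∉ Set.range I} × Fin k) = k * (Nat.card J - k) := by
  rw [Nat.card_prod, Nat.card_fin, mul_comm]
  congr 1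
  have h1 : Nat.card {j : J // j ∉ Set.range I} = (Set.range I)ᶜ.ncard := Nat.card_coe_set_eq (Set.range I)ᶜ
  have h2 := Set.ncard_add_ncard_compl (Set.range I)
  have h3 : (Set.range I).ncard = k := by rw [Set.ncard_range_of_injective hI, Nat.card_fin]
  omega

variable [Module.Finite ℤ M] [Module.Free ℤ M]

/-- **THE GRASSMANNIAN IS SMOOTH OVER `ℤ` OF RELATIVE DIMENSION `k (n − k)`** (`n = finrank_ℤ M`): for a finite free abelian
group `M` and `k : ℕ`, the structure morphism `grassmannianScheme M k → ⊤ = Spec ℤ` is `SmoothOfRelativeDimension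
(k * (finrank ℤ M - k))` (Zariski-locally on the source over the chart cover by the affine spaces `Spec ℤ[X_{σ_I × Fin k}]`,
`#(σ_I × Fin k) = k (n − k)`). [cite: GortzWedhorn2020, Cor. 8.15 (p. 216)] [cite: StacksProject, Tag 089T] -/
theorem smoothOfRelativeDimension_terminal_from :
    SmoothOfRelativeDimension (k * (Module.finrank ℤ M - k)) (terminal.from (grassmannianScheme M k)) := by
  obtain ⟨g, hg, hcov, -⟩ :=
    exists_openImmersion_chartScheme_cover k M (Module.Free.chooseBasis ℤ M)
  let 𝒰 : (grassmannianScheme M k).OpenCover :=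
    Scheme.Cover.mkOfCovers {I : Fin k → Module.Free.ChooseBasisIndex ℤ M // Function.Injective I}
      (fun I => chartScheme k I.1) g (fun y => by
        obtain ⟨I, z, hz⟩ := hcov y
        exact ⟨I, z, hz⟩) hg
  refine IsZariskiLocalAtSource.of_openCover 𝒰 fun I => ?_
  rw [terminal.comp_from]
  have hd : Nat.card ({j : Module.Free.ChooseBasisIndex ℤ M // j ∉ Set.range I.1} × Fin k) =
      k * (Module.finrank ℤ M - k) := by
    rw [natCard_chartVars k I.1 I.2, Module.finrank_eq_nat_card_basis (Module.Free.chooseBasis ℤ M)]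
  rw [← hd]
  exact smoothOfRelativeDimension_terminal_from_chartScheme k I.1

end RelativeDimension

end Literature.AlgebraicGeometry.Motives.Grassmannian
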